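import Literature.AlgebraicGeometry.Resolution.VertexBlowupRationalFunctions
import Literature.AlgebraicGeometry.Resolution.PointBlowupProjectionRingHom
import Literature.AlgebraicGeometry.Resolution.AlterationsLemma411VertexProjection
import HarnessLib

/-!
# The blow-up of `ℙ^{d+1}` in the vertex: the projection `q : P̃ → ℙ^d` as a morphism

Topic: `Literature/AlgebraicGeometry/Resolution`. Third scheme-level step of the construction of
de Jong 1996, proof of Lemma 4.11 (p. 68): for ANY blowing up `b : P̃ → ℙ^{d+1}_k` of projective
space in the vertex `p = (0 : … : 0 : 1)` (`IsBlowup b I_{p}`), **the linear projection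
`q = pr_p ∘ b : P̃ → ℙ^d_k`, `(x₀ : … : x_{d+1}) ↦ (x₀ : … : x_d)`, made a morphism** — the
morphism of the vector of rational functions `(z₀ : … : z_d)`, `z_j = b^*(x_j/x_{d+1})`
(`VertexBlowupRationalFunctions.lean`; Hartshorne II Thm. 7.1 via
`Resolution/RationalFunctionsToProjectiveSpace.lean`), which is defined everywhere on `P̃`.
PROVED here:

* `DeJong1996.vertexBlowupProjection hb : P̃ → ℙ^d` and `vertexBlowupProjection_toSpec` — it is
  a `k`-morphism;
* `DeJong1996.vertexChart_comp_vertexBlowupProjection` — **on the `i`-th chart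
  `Spec Cᵢ = Spec k[X][I/Xᵢ]` over `D₊(x_{d+1})`, `q` is `Spec` of `y_a/yᵢ ↦ X_a/Xᵢ` followed by
  `D₊(yᵢ) ↪ ℙ^d`** (`PointBlowup.projRingHom`): both are the chart map of the linear system
  through `D₊(yᵢ)`, whose ring map is pinned down by its values on constants and on the `y_a/yᵢ`
  (`DeJong1996.awayRingHom_ext`); the value on `y_a/yᵢ` is the pull-back of the ratio section
  `z_a/zᵢ`, identified on the chart with `X_a/Xᵢ` by comparing rational functions;
* `DeJong1996.isVertexProjection_vertexBlowupProjection` — **`q = pr_p ∘ b` off the exceptional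
  locus** (`DeJong1996.IsVertexProjection d k b q`, the chart condition of
  `AlterationsLemma411Vertex.lean`): over `D₊(xᵢ)`, `i ≤ d`, the ratio section `z_a/zᵢ` is
  `b^*(x_a/xᵢ)`, so the chart map of the linear system is `b` followed by
  `vertexProjectionChart d k i`.

No named facts; the only definition is `vertexBlowupProjection` (an instance of `toProjOfVec`).

## Sources

* A. J. de Jong, *Smoothness, semi-stability and alterations*, Publ. Math. IHÉS 83 (1996),
  proof of Lemma 4.11, p. 68 ("`X' = {(x, ℓ) | π(x) ∈ ℓ}`, `f = pr₂`"). [DeJong1996]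
* R. Hartshorne, *Algebraic Geometry* (1977), II Thm. 7.1. [Hartshorne1977]
-/

noncomputable section

open CategoryTheory CategoryTheory.Limits AlgebraicGeometry TopologicalSpace HomogeneousLocalization

attribute [local instance] MvPolynomial.gradedAlgebra
  Literature.AlgebraicGeometry.Motives.ProjBaseChange.algebraBase
  Literature.AlgebraicGeometry.Motives.ProjBaseChange.isScalarTower_localization

namespace Literature.AlgebraicGeometry.Resolution

universe u

open Literature.AlgebraicGeometry.Motives (projectiveSpace GeneratingSections)
open Literature.AlgebraicGeometry.Motives.Segre (grading chartι toSpec X_mem frac cst pull pull_apply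
  pull_comp pull_SpecMap' pull_SpecMap toSpecΓ_SpecMap_pull toSpecΓ_SpecMap_pull_assoc chartι_toSpec)
open Literature.AlgebraicGeometry.Motives.RatFn

namespace DeJong1996

variable {d : ℕ} {k : Type u} [Field k]
variable {P : Scheme.{u}} {b : P ⟶ Proj (grading (Fin (d + 1 + 1)) k)}

/-! ## The projection -/

section Projection

variable (b) [IsIntegral P] [IsDominant b]

/-- **The projection `q : P̃ → ℙ^d_k` from the vertex** for a blowing up `b : P̃ → ℙ^{d+1}_k` of
projective space in the vertex: the morphism `(z₀ : … : z_d)` of the rational functions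
`z_j = b^*(x_j/x_{d+1})`, defined everywhere (`isDefinedAt_blowupRatFn`). This is de Jong's
`f = pr₂ : X' = {(x, ℓ) | x ∈ ℓ} → ℙ^{d-1}` for `X = ℙ^d` (his indexing), i.e. the linear
projection `pr_p` made a morphism on the blow-up. [cite: DeJong1996, Lemma 4.11 (proof), p. 68] -/
def vertexBlowupProjection (hb : IsBlowup b (vertexIdealSheaf d k)) : P ⟶ Proj (grading (Fin (d + 1)) k) :=
  toProjOfVec (blowupRatFn b) (b ≫ toSpec (Fin (d + 1 + 1)) k) (isDefinedAt_blowupRatFn b hb)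

/-- `q` is a morphism over `k`: `q ≫ (ℙ^d → Spec k) = b ≫ (ℙ^{d+1} → Spec k)`. [folklore] -/
@[reassoc]
theorem vertexBlowupProjection_toSpec (hb : IsBlowup b (vertexIdealSheaf d k)) :
    vertexBlowupProjection b hb ≫ toSpec (Fin (d + 1)) k = b ≫ toSpec (Fin (d + 1 + 1)) k :=
  toProjOfVec_toSpec _ _ _

end Projection

/-! ## Auxiliary: the chart ring is a domain; pulling back along `Spec` of a ring map -/

/-- `k[X][1/Xᵢ]` is a domain. [folklore] -/
instance isDomain_away_X_polynomial (i : Fin (d + 1)) :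
    IsDomain (Localization.Away (MvPolynomial.X i : MvPolynomial (Fin (d + 1)) k)) :=
  IsLocalization.isDomain_localization
    ((Submonoid.powers_le (P := nonZeroDivisors _)).mpr (MvPolynomial.isRegular_X).mem_nonZeroDivisors)

/-- The chart ring `Cᵢ = k[X][I/Xᵢ] ⊆ k[X][1/Xᵢ]` is a domain. [folklore] -/
instance isDomain_pointBlowupChart (i : Fin (d + 1)) : IsDomain (PointBlowup.Chart d k i) :=
  inferInstance

/-- Pulling back along `Spec F : Spec S → Spec R`: `pull (Spec F) r = (ΓSpecIso S)⁻¹ (F r)`.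
[folklore] -/
theorem pull_SpecMap_ofHom {R S : Type u} [CommRing R] [CommRing S] (F : R →+* S) (r : R) :
    pull (Spec.map (CommRingCat.ofHom F)) r = (Scheme.ΓSpecIso (.of S)).inv (F r) := by
  change ((Scheme.ΓSpecIso (.of R)).inv ≫ (Spec.map (CommRingCat.ofHom F)).appTop) r = _
  rw [← Scheme.ΓSpecIso_inv_naturality]
  rfl

/-! ## `q` on the charts over `D₊(x_{d+1})` -/

section Charts

variable (b) [IsIntegral P] [IsDominant b] (hb : IsBlowup b (vertexIdealSheaf d k))

/-- The chart `Spec Cᵢ → P̃` maps into the `i`-th chart of the linear system of `z`. [folklore] -/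
theorem top_le_vertexChart_preimage_lsChart (i : Fin (d + 1)) :
    ⊤ ≤ vertexChart hb i ⁻¹ᵁ lsChart (blowupRatFn b) i := fun x _ =>
  opensRange_vertexChart_le_lsChart b hb i ⟨x, rfl⟩

omit [IsIntegral P] [IsDominant b] in
/-- `Spec Cᵢ → P̃ → ℙ^{d+1} → Spec k` is `Spec` of the `k`-structure map of `Cᵢ`. [folklore] -/
theorem vertexChart_comp_comp_toSpec (i : Fin (d + 1)) :
    vertexChart hb i ≫ b ≫ toSpec (Fin (d + 1 + 1)) k =
      Spec.map (CommRingCat.ofHom (algebraMap k (PointBlowup.Chart d k i))) := by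
  rw [vertexChart_comp_assoc, Motives.ProjSubscheme.fromSpec_affineBasicOpen, Category.assoc]
  change _ ≫ _ ≫ chartι k (Fin.last (d + 1)) ≫ toSpec (Fin (d + 1 + 1)) k = _
  rw [chartι_toSpec, ← Spec.map_comp, ← Spec.map_comp]
  congr 1
  refine CommRingCat.hom_ext (RingHom.ext fun c => ?_)
  simp only [CommRingCat.hom_comp, CommRingCat.hom_ofHom, RingHom.comp_apply]
  change toChart d k i (Proj.awayToSection _ _ (cst k (MvPolynomial.X (Fin.last (d + 1))) c)) = _
  rw [toChart, RingHom.comp_apply, RingEquiv.toRingHom_eq_coe, RingEquiv.coe_toRingHom,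
    lastChartEquiv_awayToSection, PointBlowup.cst_eq_algebraMap, AlgEquiv.commutes,
    ← IsScalarTower.algebraMap_apply]

omit [IsDominant b] in
/-- The generic point of `P̃` lies in the image of every chart `Spec Cᵢ → P̃` (a non-empty open
of the irreducible `P̃`). [folklore] -/
theorem genericPoint_mem_image_top (i : Fin (d + 1)) :
    genericPoint P ∈ vertexChart hb i ''ᵁ ⊤ := by
  obtain ⟨x⟩ := (inferInstance : Nonempty (Spec (.of (PointBlowup.Chart d k i))))
  exact genericPoint_mem_of_mem (U := vertexChart hb i ''ᵁ ⊤) ⟨x, trivial, rfl⟩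

omit [IsIntegral P] [IsDominant b] in
/-- The image of the chart `Spec Cᵢ → P̃` lies over `D₊(x_{d+1})`. [folklore] -/
theorem image_top_le_preimage_lastChart (i : Fin (d + 1)) :
    vertexChart hb i ''ᵁ ⊤ ≤ b ⁻¹ᵁ (lastChart d k : (Proj (grading (Fin (d + 1 + 1)) k)).Opens) :=
  (Scheme.Hom.image_top_eq_opensRange _).le.trans (opensRange_vertexChart_le hb i)

omit [IsIntegral P] [IsDominant b] in
/-- **The pull-back of `b^*(xⱼ/x_{d+1})` to the chart `Spec Cᵢ` is `Xⱼ = Xᵢ · (Xⱼ/Xᵢ)`**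
(through `Γ(P̃, image of the chart) ≅ Γ(Spec Cᵢ, ⊤) ≅ Cᵢ`). [folklore] -/
theorem appIso_hom_blowupSection (i j : Fin (d + 1)) :
    ((vertexChart hb i).appIso ⊤).hom
        (P.presheaf.map (homOfLE (image_top_le_preimage_lastChart b hb i)).op (blowupSection b j)) =
      (Scheme.ΓSpecIso (.of (PointBlowup.Chart d k i))).inv
        (PointBlowup.exc d k i * PointBlowup.frac d k i j) := by
  have h₂ : (⊤ : (Spec (.of (PointBlowup.Chart d k i))).Opens) ≤
      vertexChart hb i ⁻¹ᵁ (b ⁻¹ᵁ (lastChart d k : (Proj (grading (Fin (d + 1 + 1)) k)).Opens)) :=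
    fun x _ => image_top_le_preimage_lastChart b hb i ⟨x, trivial, rfl⟩
  have e₁ : (⊤ : (Spec Γ(Proj (grading (Fin (d + 1 + 1)) k),
      (lastChart d k : (Proj (grading (Fin (d + 1 + 1)) k)).Opens))).Opens) ≤
      (lastChart d k).2.fromSpec ⁻¹ᵁ (lastChart d k : (Proj (grading (Fin (d + 1 + 1)) k)).Opens) := by
    rw [IsAffineOpen.fromSpec_preimage_self]
  calc ((vertexChart hb i).appIso ⊤).hom
        (P.presheaf.map (homOfLE (image_top_le_preimage_lastChart b hb i)).op (blowupSection b j))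
      = (vertexChart hb i).appLE _ ⊤ h₂ (blowupSection b j) := by
          rw [Scheme.Hom.appIso_hom', ← CommRingCat.comp_apply, Scheme.Hom.map_appLE]
    _ = ((vertexChart hb i ≫ b).appLE _ ⊤ (by exact h₂)) (vertexSection d k j) := by
          rw [blowupSection, Scheme.Hom.app_eq_appLE, ← CommRingCat.comp_apply,
            Scheme.Hom.appLE_comp_appLE]
    _ = ((Spec.map (CommRingCat.ofHom (toChart d k i)) ≫ (lastChart d k).2.fromSpec).appLE _ ⊤
          ((vertexChart_comp hb i) ▸ h₂)) (vertexSection d k j) := by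
          rw [appLE_congr_hom (vertexChart_comp hb i)]
    _ = (Spec.map (CommRingCat.ofHom (toChart d k i))).appLE ⊤ ⊤ le_top
          ((lastChart d k).2.fromSpec.appLE _ ⊤ e₁ (vertexSection d k j)) := by
          rw [← CommRingCat.comp_apply, Scheme.Hom.appLE_comp_appLE]
    _ = (Scheme.ΓSpecIso (.of (PointBlowup.Chart d k i))).inv (toChart d k i (vertexSection d k j)) := by
          rw [fromSpec_appLE_top, GeneratingSections.appLE_top_top, ← CommRingCat.comp_apply,
            ← Scheme.ΓSpecIso_inv_naturality, CommRingCat.comp_apply]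
          rfl
    _ = _ := by rw [toChart_vertexSection]

/-- **The ratio section `z_a/zᵢ` pulled back to the chart `Spec Cᵢ` is `X_a/Xᵢ`** (both have
the rational function `z_a/zᵢ`: `(X_a/Xᵢ) · b^*(xᵢ/x_{d+1}) = b^*(x_a/x_{d+1})` on the chart).
[folklore] -/
theorem appLE_lsRatio_eq (i a : Fin (d + 1)) :
    (vertexChart hb i).appLE (lsChart (blowupRatFn b) i) ⊤ (top_le_vertexChart_preimage_lsChart b hb i)
        (lsRatio (blowupRatFn b) i a) =
      (Scheme.ΓSpecIso (.of (PointBlowup.Chart d k i))).inv (PointBlowup.frac d k i a) := by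
  set c := vertexChart hb i with hc
  set W : P.Opens := c ''ᵁ ⊤ with hW
  have hWls : W ≤ lsChart (blowupRatFn b) i :=
    (Scheme.Hom.image_top_eq_opensRange c).le.trans (opensRange_vertexChart_le_lsChart b hb i)
  have hWb : W ≤ b ⁻¹ᵁ (lastChart d k : (Proj (grading (Fin (d + 1 + 1)) k)).Opens) :=
    image_top_le_preimage_lastChart b hb i
  have hη : genericPoint P ∈ W := genericPoint_mem_image_top b hb i
  -- the section `τ` on `W` corresponding to `X_a/Xᵢ`
  set τ : Γ(P, W) := (c.appIso ⊤).inv ((Scheme.ΓSpecIso (.of (PointBlowup.Chart d k i))).inv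
    (PointBlowup.frac d k i a)) with hτ
  -- it has the rational function `z_a/zᵢ`
  have hτz : ofSection hη τ = blowupRatFn b a / blowupRatFn b i := by
    rw [eq_div_iff (blowupRatFn_ne_zero b i)]
    have hzi : blowupRatFn b i = ofSection hη (P.presheaf.map (homOfLE hWb).op (blowupSection b i)) := by
      rw [ofSection_map, ofSection_blowupSection]
    have hza : blowupRatFn b a = ofSection hη (P.presheaf.map (homOfLE hWb).op (blowupSection b a)) := by
      rw [ofSection_map, ofSection_blowupSection]
    rw [hzi, hza, ← map_mul]
    congr 1
    apply (c.appIso ⊤).commRingCatIsoToRingEquiv.injective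
    change (c.appIso ⊤).hom (τ * _) = (c.appIso ⊤).hom _
    rw [map_mul, appIso_hom_blowupSection, appIso_hom_blowupSection, hτ, ← CommRingCat.comp_apply,
      Iso.inv_hom_id, CommRingCat.id_apply, ← map_mul, PointBlowup.frac_self, mul_one, mul_comm]
  -- hence it is the restriction of the ratio section
  have hres : P.presheaf.map (homOfLE hWls).op (lsRatio (blowupRatFn b) i a) = τ := by
    apply ofSection_injective hη
    rw [ofSection_map, ofSection_lsRatio _ (blowupRatFn_ne_zero b i), hτz]
  -- read through the chart
  have e1 : c.appLE (lsChart (blowupRatFn b) i) ⊤ (top_le_vertexChart_preimage_lsChart b hb i) =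
      P.presheaf.map (homOfLE hWls).op ≫ c.appLE W ⊤ (by rw [hW, Scheme.Hom.preimage_image_eq]) := by
    rw [Scheme.Hom.map_appLE]
  rw [e1, CommRingCat.comp_apply, hres, hτ, ← Scheme.Hom.appIso_hom', ← CommRingCat.comp_apply,
    Iso.inv_hom_id, CommRingCat.id_apply]

/-- **`q` on the `i`-th chart `Spec Cᵢ → P̃` is `Spec (y_a/yᵢ ↦ X_a/Xᵢ)` followed by
`D₊(yᵢ) ↪ ℙ^d`** — the local form of the projection from the vertex on the blow-up of
`𝔸^{d+1}` in the origin ("`f` along `Eᵢ` looks like `pr_p : P̃^d → ℙ^{d-1}`").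
[cite: DeJong1996, Lemma 4.11 (proof), p. 68] -/
theorem vertexChart_comp_vertexBlowupProjection (i : Fin (d + 1)) :
    vertexChart hb i ≫ vertexBlowupProjection b hb =
      Spec.map (CommRingCat.ofHom (PointBlowup.projRingHom d k i)) ≫ chartι k i := by
  have hg := top_le_vertexChart_preimage_lsChart b hb i
  rw [vertexBlowupProjection, comp_toProjOfVec _ _ _ (vertexChart hb i) hg, GeneratingSections.chartMap]
  have key : (linearSystem (blowupRatFn b) (isDefinedAt_blowupRatFn b hb)).chartRingHom
      (b ≫ toSpec (Fin (d + 1 + 1)) k) i (vertexChart hb i) hg =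
      pull (Spec.map (CommRingCat.ofHom (PointBlowup.projRingHom d k i))) := by
    apply awayRingHom_ext k
    · rw [GeneratingSections.chartRingHom_comp_cst, ← CommRingCat.hom_ofHom (cst k (MvPolynomial.X i)),
        ← pull_SpecMap', ← Spec.map_comp, ← CommRingCat.ofHom_comp, PointBlowup.projRingHom_comp_cst,
        vertexChart_comp_comp_toSpec]
    · intro a
      rw [GeneratingSections.chartRingHom_frac, pull_SpecMap_ofHom, PointBlowup.projRingHom_frac]
      exact appLE_lsRatio_eq b hb i a
  rw [key, toSpecΓ_SpecMap_pull_assoc]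

end Charts

/-! ## `q = pr_p ∘ b` off the exceptional locus -/

section OffCentre

variable (b) [IsIntegral P] [IsDominant b] (hb : IsBlowup b (vertexIdealSheaf d k))

/-- **Over `D₊(xᵢ)`, `i ≤ d`, the ratio section `z_a/zᵢ` is `b^*(x_a/xᵢ)`** (both have the
rational function `b^*(x_a/xᵢ) = z_a/zᵢ`). [folklore] -/
theorem map_lsRatio_eq_app_ratio (i a : Fin (d + 1)) :
    P.presheaf.map (homOfLE (preimage_basicOpen_le_lsChart b i)).op (lsRatio (blowupRatFn b) i a) =
      b.app ((gensP d k).U (Fin.castSucc i)) ((gensP d k).ratio (Fin.castSucc i) (Fin.castSucc a)) := by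
  have hη : genericPoint P ∈ b ⁻¹ᵁ (gensP d k).U (Fin.castSucc i) :=
    genericPoint_mem_preimage b (Motives.ProjSpace.genericPoint_mem_U (Fin.castSucc i))
  apply ofSection_injective hη
  refine (ofSection_map (homOfLE (preimage_basicOpen_le_lsChart b i)) hη (lsRatio (blowupRatFn b) i a)).trans ?_
  rw [ofSection_lsRatio _ (blowupRatFn_ne_zero b i), ofSection_app_eq, blowupRatFn_div, vertexRatFn_div]
  rfl

variable {b} in
omit [IsIntegral P] [IsDominant b] in
/-- The first projection of `P̃ ×_{ℙ^{d+1}} D₊(xᵢ)` lands in `b⁻¹ D₊(xᵢ)`. [folklore] -/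
theorem top_le_fst_preimage (i : Fin (d + 1)) :
    ⊤ ≤ pullback.fst b (chartι k (Fin.castSucc i)) ⁻¹ᵁ
      (b ⁻¹ᵁ Proj.basicOpen (grading (Fin (d + 1 + 1)) k) (MvPolynomial.X (Fin.castSucc i))) := by
  intro x _
  change b (pullback.fst b (chartι k (Fin.castSucc i)) x) ∈
    Proj.basicOpen (grading (Fin (d + 1 + 1)) k) (MvPolynomial.X (Fin.castSucc i))
  rw [← Scheme.Hom.comp_apply, pullback.condition, Scheme.Hom.comp_apply,
    ← Proj.opensRange_awayι _ _ (X_mem k (Fin.castSucc i)) zero_lt_one]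
  exact ⟨_, rfl⟩

/-- **On `D₊(xᵢ)`, the sections of the identity's generating data pull back along `chartι` to the
fractions themselves**: `chartι^*(x_a/xᵢ as a section) = (ΓSpecIso)⁻¹ (x_a/xᵢ)`. [folklore] -/
theorem appLE_chartι_ratio (i a : Fin (d + 1 + 1)) :
    (chartι k i).appLE ((gensP d k).U i) ⊤
        (fun x _ => show chartι k i x ∈ Proj.basicOpen (grading (Fin (d + 1 + 1)) k) (MvPolynomial.X i) by
          rw [← Proj.opensRange_awayι _ _ (X_mem k i) zero_lt_one]; exact ⟨x, rfl⟩)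
        ((gensP d k).ratio i a) =
      (Scheme.ΓSpecIso (.of (Away (grading (Fin (d + 1 + 1)) k) (MvPolynomial.X i)))).inv (frac k i a) := by
  -- `chartι = (chartLift 𝟙 i)⁻¹ ≫ ι`, `chartLift 𝟙 i = basicOpenIsoSpec.hom`
  set e := Proj.basicOpenIsoSpec (grading (Fin (d + 1 + 1)) k) (MvPolynomial.X i) (X_mem k i) zero_lt_one
    with he
  have hι : chartι k i = e.inv ≫ ((gensP d k).U i).ι := (Proj.basicOpenIsoSpec_inv_ι _ _ _ _).symm
  have h1 : (gensP d k).ratio i a = ((gensP d k).U i).topIso.hom (pull e.hom (frac k i a)) := by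
    change GeneratingSections.homRatio _ i a = _
    rw [GeneratingSections.homRatio, Motives.ProjSpace.chartLift_id_eq]
    rfl
  have h' : ⊤ ≤ ((gensP d k).U i).ι ⁻¹ᵁ (gensP d k).U i := GeneratingSections.top_le_ι_preimage _
  have h'e : ⊤ ≤ (e.inv ≫ ((gensP d k).U i).ι) ⁻¹ᵁ (gensP d k).U i := fun x _ =>
    show ((gensP d k).U i).ι (e.inv x) ∈ (gensP d k).U i from (e.inv x).2
  have h2 : (e.inv ≫ ((gensP d k).U i).ι).appLE ((gensP d k).U i) ⊤ h'e =
      ((gensP d k).U i).ι.appLE ((gensP d k).U i) ⊤ h' ≫ e.inv.appLE ⊤ ⊤ le_top :=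
    (Scheme.Hom.appLE_comp_appLE e.inv ((gensP d k).U i).ι ((gensP d k).U i) ⊤ ⊤ h' le_top).symm
  rw [appLE_congr_hom hι, h2, CommRingCat.comp_apply, h1]
  change e.inv.appLE ⊤ ⊤ le_top (GeneratingSections.res ((gensP d k).U i).ι ((gensP d k).U i) h'
    (((gensP d k).U i).topIso.hom (pull e.hom (frac k i a)))) = _
  rw [res_ι_topIso_hom, GeneratingSections.appLE_top_top, pull_apply, ← CommRingCat.comp_apply,
    ← Scheme.Hom.comp_appTop, e.inv_hom_id, Scheme.Hom.id_appTop, CommRingCat.id_apply]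

/-- **`q = pr_p ∘ b` on `b⁻¹ D₊(xᵢ)`, `i ≤ d`**: the projection from the vertex made a morphism on
the blow-up restricts, off the exceptional locus, to the linear projection composed with `b`
(`DeJong1996.IsVertexProjection`). [cite: DeJong1996, Lemma 4.11 (proof), p. 68] -/
theorem isVertexProjection_vertexBlowupProjection :
    IsVertexProjection d k b (vertexBlowupProjection b hb) := by
  refine ⟨fun i => ?_⟩
  have hgV := top_le_fst_preimage (k := k) (b := b) i
  have hg : ⊤ ≤ pullback.fst b (chartι k (Fin.castSucc i)) ⁻¹ᵁ lsChart (blowupRatFn b) i :=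
    hgV.trans (Scheme.Hom.preimage_mono _ (preimage_basicOpen_le_lsChart b i))
  change pullback.fst b (chartι k (Fin.castSucc i)) ≫ vertexBlowupProjection b hb =
    pullback.snd b (chartι k (Fin.castSucc i)) ≫ vertexProjectionChart d k i
  rw [vertexBlowupProjection, comp_toProjOfVec _ _ _ (pullback.fst b (chartι k (Fin.castSucc i))) hg,
    GeneratingSections.chartMap, vertexProjectionChart]
  have key : (linearSystem (blowupRatFn b) (isDefinedAt_blowupRatFn b hb)).chartRingHom
      (b ≫ toSpec (Fin (d + 1 + 1)) k) i (pullback.fst b (chartι k (Fin.castSucc i))) hg =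
      pull (pullback.snd b (chartι k (Fin.castSucc i)) ≫
        Spec.map (CommRingCat.ofHom (vertexProjectionRingHom d k i))) := by
    apply awayRingHom_ext k
    · rw [GeneratingSections.chartRingHom_comp_cst, ← CommRingCat.hom_ofHom (cst k (MvPolynomial.X i)),
        ← pull_SpecMap', Category.assoc, ← Spec.map_comp, ← CommRingCat.ofHom_comp,
        vertexProjectionRingHom_comp_cst, ← chartι_toSpec, pullback.condition_assoc]
    · intro a
      rw [GeneratingSections.chartRingHom_frac, pull_SpecMap]
      change (pullback.fst b (chartι k (Fin.castSucc i))).appLE (lsChart (blowupRatFn b) i) ⊤ hg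
        (lsRatio (blowupRatFn b) i a) =
        pull (pullback.snd b (chartι k (Fin.castSucc i))) (vertexProjectionRingHom d k i (frac k i a))
      rw [vertexProjectionRingHom_frac, pull_apply]
      have e1 : (pullback.fst b (chartι k (Fin.castSucc i))).appLE (lsChart (blowupRatFn b) i) ⊤ hg =
          P.presheaf.map (homOfLE (preimage_basicOpen_le_lsChart b i)).op ≫
            (pullback.fst b (chartι k (Fin.castSucc i))).appLE _ ⊤ hgV := by
        rw [Scheme.Hom.map_appLE]
      rw [e1, CommRingCat.comp_apply, map_lsRatio_eq_app_ratio, Scheme.Hom.app_eq_appLE]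
      have h3 : ⊤ ≤ (pullback.snd b (chartι k (Fin.castSucc i)) ≫ chartι k (Fin.castSucc i)) ⁻¹ᵁ
          (gensP d k).U (Fin.castSucc i) := by
        rw [← pullback.condition]; exact hgV
      calc ((pullback.fst b (chartι k (Fin.castSucc i))).appLE _ ⊤ hgV)
            ((b.appLE ((gensP d k).U (Fin.castSucc i)) _ le_rfl) ((gensP d k).ratio (Fin.castSucc i) (Fin.castSucc a)))
          = (b.appLE ((gensP d k).U (Fin.castSucc i)) _ le_rfl ≫
              (pullback.fst b (chartι k (Fin.castSucc i))).appLE _ ⊤ hgV)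
              ((gensP d k).ratio (Fin.castSucc i) (Fin.castSucc a)) := (CommRingCat.comp_apply _ _ _).symm
        _ = ((pullback.fst b (chartι k (Fin.castSucc i)) ≫ b).appLE ((gensP d k).U (Fin.castSucc i)) ⊤
              (by exact hgV)) ((gensP d k).ratio (Fin.castSucc i) (Fin.castSucc a)) := by
            rw [Scheme.Hom.appLE_comp_appLE]
        _ = ((pullback.snd b (chartι k (Fin.castSucc i)) ≫ chartι k (Fin.castSucc i)).appLE
              ((gensP d k).U (Fin.castSucc i)) ⊤ h3) ((gensP d k).ratio (Fin.castSucc i) (Fin.castSucc a)) := by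
            rw [appLE_congr_hom (pullback.condition (f := b) (g := chartι k (Fin.castSucc i)))]
        _ = ((chartι k (Fin.castSucc i)).appLE ((gensP d k).U (Fin.castSucc i)) ⊤
                (fun x _ => show chartι k (Fin.castSucc i) x ∈
                    Proj.basicOpen (grading (Fin (d + 1 + 1)) k) (MvPolynomial.X (Fin.castSucc i)) by
                  rw [← Proj.opensRange_awayι _ _ (X_mem k (Fin.castSucc i)) zero_lt_one]; exact ⟨x, rfl⟩) ≫
              (pullback.snd b (chartι k (Fin.castSucc i))).appLE ⊤ ⊤ le_top)
              ((gensP d k).ratio (Fin.castSucc i) (Fin.castSucc a)) := by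
            rw [Scheme.Hom.appLE_comp_appLE]
        _ = (pullback.snd b (chartι k (Fin.castSucc i))).appTop
              ((Scheme.ΓSpecIso (.of (Away (grading (Fin (d + 1 + 1)) k)
                (MvPolynomial.X (Fin.castSucc i))))).inv (frac k (Fin.castSucc i) (Fin.castSucc a))) := by
            rw [CommRingCat.comp_apply, appLE_chartι_ratio, GeneratingSections.appLE_top_top]
        _ = _ := (CommRingCat.comp_apply _ _ _).symm
  rw [key, toSpecΓ_SpecMap_pull_assoc, Category.assoc]

end OffCentre

end DeJong1996

end Literature.AlgebraicGeometry.Resolution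

end
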